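import Summits.HubbardSuperconductivity.HubbardSuperconductivity.Theorems.AnisotropyChordInsertionEntropyJastrowScreening

/-!
# Route `AnisotropyChord` / H0 rotor rung: the RESAMPLING ROUTE for a general Jastrow kernel — the teleportation
# entropy as a covariance, the `KL` bound from the particle–hole floor and the energy floor, and the condensate
# floor (kernel-generic port of theory seat `hubbard-h0-rotor-theory-1`, Sketch9 Parts O/P
# `klDiv_halfSheet_le_of_energyFloor`, `condensate_of_energyFloor`, memo ROTOR-THEORY-9 §135(s)(t))

For an even kernel `W` on a finite abelian group `G` with `W 0 = 0`, `0 ≤ W ≤ B`, and the canonical state `jAmp W N`: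
* `klDiv_jAmp_cloud` (canonical J3′) and **`klDiv_jAmp_eq_wcov_div`**:
  `KL(ν_x^{(y)} ‖ ν_y^{(x)}) = cov(1_A, X̃)/μ(A)`, `A = {x occupied, y empty}`, `X̃ = Φ_y − Φ_x − W(x−y)(n_x − n_y)`;
* `JastrowParticleHoleFloor W N c₀` (T0 shape) and **`klDiv_jAmp_le_of_energyFloor`**:
  T0 with `c₀` and `JastrowEnergyFloor W N E` give `KL ≤ (2E + 4e^E + B)/c₀` (via the soft `L¹` screening bound);
* **`condensateDensity_jAmp_ge_of_klDiv`** (one-state E-floor for `jAmp`) and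
  **`condensateDensity_jAmp_ge_of_floors`**: T0 ∧ energy floor ⟹
  `n₀/|G| ≥ (N/|G|)(1 − N/|G|)·exp(−(2E + 4e^E + B)/(2c₀))`.
-/

set_option linter.dupNamespace false

noncomputable section

open Finset

namespace Summit.HubbardSuperconductivity.HubbardSuperconductivity.Theorems.AnisotropyChord.InsertionEntropy

section JastrowResamplingKL

variable {G : Type} [AddCommGroup G] [Fintype G] [DecidableEq G]

/-- **T0 shape `JastrowParticleHoleFloor W N c₀`:** `μ(n_x(1−n_y)) ≥ c₀` for all `x ≠ y` in the canonical Jastrow state.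
(theory seat Sketch9 Part N `SheetParticleHoleFloor`, generalised) [folklore] -/
def JastrowParticleHoleFloor (W : G → ℝ) (N : ℕ) (c₀ : ℝ) : Prop :=
  ∀ x y : G, x ≠ y → c₀ ≤ probPH (jAmp W N) x y

/-- **Canonical J3′ for a difference kernel (PROVED):** `KL(ν_x^{(y)} ‖ ν_y^{(x)}) = Σ_z (condOcc(z) − m)(W(z−y) − W(z−x))`
for every background `m` (non-empty sector). [folklore] -/
theorem klDiv_jAmp_cloud (W : G → ℝ) (hWe : ∀ z, W (-z) = W z) (N : ℕ)
    (hZ : 0 < jastrowSectorWeight (fun u v : G => W (u - v)) N) (x y : G) (m : ℝ) :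
    klDiv (teleLaw (jAmp W N) x y) (teleLaw (jAmp W N) y x)
      = ∑ z, (condOcc (jAmp W N) x y z - m) * (W (z - y) - W (z - x)) := by
  have hw : ∀ u v : G, W (u - v) = W (v - u) := fun u v => by rw [← hWe (u - v), neg_sub]
  have h := klDiv_teleLaw_jastrowSector (fun u v : G => W (u - v)) hw N hZ x y (by simp)
    (pairMass_symm_jAmp W N y x)
  exact klDiv_eq_cloud_of_eq_spectator W _ x y m h

/-- **KL AS A COVARIANCE (PROVED):** for `x ≠ y` (non-empty sector, positive pair mass),
`KL(ν_x^{(y)} ‖ ν_y^{(x)}) = cov(1_A, X̃)/μ(A)` with `A = {x occ., y empty}` and the restricted dipole statistic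
`X̃ = Φ_y − Φ_x − W(x−y)(n_x − n_y)` (`W` even, `W 0 = 0`). (theory seat Sketch9 Part O, steps 1–2) [folklore] -/
theorem klDiv_jAmp_eq_wcov_div (W : G → ℝ) (hWe : ∀ z, W (-z) = W z) (hW0 : W 0 = 0) (N : ℕ)
    (hN : N ≤ Fintype.card G) (x y : G) (hxy : x ≠ y) (hM : 0 < pairMass (jAmp W N) x y) :
    klDiv (teleLaw (jAmp W N) x y) (teleLaw (jAmp W N) y x)
      = wcov (jAmp W N) (fun σ => occ σ x * (1 - occ σ y))
          (fun σ => jPot W y σ + (-1) * jPot W x σ + (-(W (x - y))) * (occ σ x - occ σ y))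
          / probPH (jAmp W N) x y := by
  have hZw := jastrowSectorWeight_jAmp_pos W N hN
  have hZ : wnorm (jAmp W N) ≠ 0 := by rw [wnorm_jAmp W N hN]; exact one_ne_zero
  have hkl : klDiv (teleLaw (jAmp W N) x y) (teleLaw (jAmp W N) y x)
      = ∑ z, (condOcc (jAmp W N) x y z - dens (jAmp W N) x) * (W (z - y) - W (z - x)) :=
    klDiv_jAmp_cloud W hWe N hZw x y _
  obtain ⟨ft, hft⟩ : ∃ ft : G → ℝ, ∀ z, ft z = if z = x ∨ z = y then 0 else W (z - y) - W (z - x) := ⟨_, fun z => rfl⟩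
  -- Step 1: KL = cov(1_A, Σ ft n)/μ(A)
  have step1 : klDiv (teleLaw (jAmp W N) x y) (teleLaw (jAmp W N) y x)
      = wcov (jAmp W N) (fun σ => occ σ x * (1 - occ σ y)) (fun σ => ∑ z, ft z * occ σ z)
          / probPH (jAmp W N) x y := by
    rw [hkl]
    have hterm : ∀ z, (condOcc (jAmp W N) x y z - dens (jAmp W N) x) * (W (z - y) - W (z - x))
        = ft z * wcov (jAmp W N) (fun σ => occ σ x * (1 - occ σ y)) (fun σ => occ σ z) / probPH (jAmp W N) x y
          + ((if z = x then -(dens (jAmp W N) x) * (W (x - y) - W 0) else 0)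
          + (if z = y then -(dens (jAmp W N) x) * (W 0 - W (y - x)) else 0)) := by
      intro z
      by_cases hzx : z = x
      · rw [hzx, hft x, if_pos (Or.inl rfl), if_pos rfl, if_neg hxy, condOcc_self_left, sub_self]
        ring
      · by_cases hzy : z = y
        · rw [hzy, hft y, if_pos (Or.inr rfl), if_neg (Ne.symm hxy), if_pos rfl, condOcc_self_right, sub_self]
          ring
        · rw [hft z, if_neg (not_or.mpr ⟨hzx, hzy⟩), if_neg hzx, if_neg hzy, add_zero,
            ← dens_jAmp_const W N z x, condOcc_sub_dens_eq_wcov _ x y z hxy hzx hZ hM.ne']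
          ring
    rw [Finset.sum_congr rfl fun z _ => hterm z, Finset.sum_add_distrib, Finset.sum_add_distrib,
      Finset.sum_ite_eq' Finset.univ x, Finset.sum_ite_eq' Finset.univ y]
    simp only [Finset.mem_univ, if_true]
    rw [← neg_sub x y, hWe, wcov_sum_right, Finset.sum_div]
    ring
  -- Step 2: Σ ft n = Φ_y − Φ_x − W(x−y)(n_x − n_y)
  have hX : (fun σ : G → Fin 2 => ∑ z, ft z * occ σ z)
      = fun σ => jPot W y σ + (-1) * jPot W x σ + (-(W (x - y))) * (occ σ x - occ σ y) := by
    funext σ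
    unfold jPot
    have hg : ∀ z, ft z * occ σ z
        = (W (z - y) * occ σ z - W (z - x) * occ σ z)
          - ((if z = x then (W (x - y) - W 0) * occ σ x else 0)
          + (if z = y then (W 0 - W (y - x)) * occ σ y else 0)) := by
      intro z
      by_cases hzx : z = x
      · rw [hzx, hft x, if_pos (Or.inl rfl), if_pos rfl, if_neg hxy, sub_self]; ring
      · by_cases hzy : z = y
        · rw [hzy, hft y, if_pos (Or.inr rfl), if_neg (Ne.symm hxy), if_pos rfl, sub_self]; ring
        · rw [hft z, if_neg (not_or.mpr ⟨hzx, hzy⟩), if_neg hzx, if_neg hzy]; ring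
    rw [Finset.sum_congr rfl fun z _ => hg z, Finset.sum_sub_distrib, Finset.sum_sub_distrib,
      Finset.sum_add_distrib, Finset.sum_ite_eq' Finset.univ x, Finset.sum_ite_eq' Finset.univ y]
    simp only [Finset.mem_univ, if_true]
    rw [← neg_sub x y, hWe, hW0]
    ring
  rw [step1, hX]

/-- **THE RESAMPLING `KL` BOUND (PROVED):** particle–hole floor `c₀` and energy floor `E` give
`KL(ν_x^{(y)} ‖ ν_y^{(x)}) ≤ (2E + 4e^{E} + B)/c₀` for all `x ≠ y` (`W` even, `W 0 = 0`, `0 ≤ W ≤ B`, `2 ≤ N`,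
`2N ≤ |G|`). (theory seat Sketch9 Part P `klDiv_halfSheet_le_of_energyFloor`, generalised) [folklore] -/
theorem klDiv_jAmp_le_of_energyFloor (W : G → ℝ) (hWe : ∀ z, W (-z) = W z) (hW0 : W 0 = 0)
    (hWnn : ∀ z, 0 ≤ W z) {B : ℝ} (hWB : ∀ z, W z ≤ B) (N : ℕ) (hN2 : 2 ≤ N) (h2N : 2 * N ≤ Fintype.card G)
    {c₀ E : ℝ} (hc₀ : 0 < c₀) (hE : 0 ≤ E) (hT0 : JastrowParticleHoleFloor W N c₀)
    (hEF : JastrowEnergyFloor W N E) (x y : G) (hxy : x ≠ y) :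
    klDiv (teleLaw (jAmp W N) x y) (teleLaw (jAmp W N) y x) ≤ (2 * E + 4 * Real.exp E + B) / c₀ := by
  have hNle : N ≤ Fintype.card G := by omega
  have hM : 0 < pairMass (jAmp W N) x y := pairMass_jAmp_pos W N (by omega) (by omega) x y hxy
  have hZ1 : wnorm (jAmp W N) = 1 := wnorm_jAmp W N hNle
  have hZ : wnorm (jAmp W N) ≠ 0 := by rw [hZ1]; exact one_ne_zero
  have hPpos : 0 < probPH (jAmp W N) x y := by
    rw [probPH_eq _ x y hxy, hZ1, div_one]; exact hM
  have hPc : c₀ ≤ probPH (jAmp W N) x y := hT0 x y hxy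
  have hB0 : 0 ≤ B := (hWnn 0).trans (hWB 0)
  rw [klDiv_jAmp_eq_wcov_div W hWe hW0 N hNle x y hxy hM]
  set X : (G → Fin 2) → ℝ := fun σ => jPot W y σ + (-1) * jPot W x σ + (-(W (x - y))) * (occ σ x - occ σ y) with hXd
  -- cov(1_A, X̃) ≤ E|X̃| ≤ E|Φ_y − c| + E|Φ_x − c| + B
  have hcov : wcov (jAmp W N) (fun σ => occ σ x * (1 - occ σ y)) X ≤ wmean (jAmp W N) (fun σ => |X σ - 0|) :=
    wcov_le_wmean_abs _ _ _ 0 hZ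
      (fun σ => mul_nonneg (occ_mem_unit σ x).1 (by linarith [(occ_mem_unit σ y).2]))
      (fun σ => by nlinarith [(occ_mem_unit σ x).1, (occ_mem_unit σ x).2, (occ_mem_unit σ y).1, (occ_mem_unit σ y).2])
  have hXabs : ∀ σ : G → Fin 2, |X σ - 0| ≤ |jPot W y σ - jMeanPot W N| + |jPot W x σ - jMeanPot W N| + B := by
    intro σ
    rw [sub_zero, hXd]
    have hW : |W (x - y)| ≤ B := by rw [abs_of_nonneg (hWnn _)]; exact hWB _
    have hd : |occ σ x - occ σ y| ≤ 1 := by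
      rw [abs_le]; constructor <;>
        linarith [(occ_mem_unit σ x).1, (occ_mem_unit σ x).2, (occ_mem_unit σ y).1, (occ_mem_unit σ y).2]
    have h3 : |(-(W (x - y))) * (occ σ x - occ σ y)| ≤ B := by
      rw [abs_mul, abs_neg]
      calc |W (x - y)| * |occ σ x - occ σ y| ≤ B * 1 := mul_le_mul hW hd (abs_nonneg _) hB0
        _ = B := mul_one B
    have hadd := abs_add_le (jPot W y σ - jMeanPot W N) (-(jPot W x σ - jMeanPot W N))
    calc |jPot W y σ + (-1) * jPot W x σ + (-(W (x - y))) * (occ σ x - occ σ y)|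
        = |(jPot W y σ - jMeanPot W N) + (-(jPot W x σ - jMeanPot W N))
            + (-(W (x - y))) * (occ σ x - occ σ y)| := by congr 1; ring
      _ ≤ |(jPot W y σ - jMeanPot W N) + (-(jPot W x σ - jMeanPot W N))|
            + |(-(W (x - y))) * (occ σ x - occ σ y)| := abs_add_le _ _
      _ ≤ |jPot W y σ - jMeanPot W N| + |(-(jPot W x σ - jMeanPot W N))|
            + |(-(W (x - y))) * (occ σ x - occ σ y)| := by linarith [hadd]
      _ ≤ _ := by rw [abs_neg]; linarith
  have hmeanX : wmean (jAmp W N) (fun σ => |X σ - 0|) ≤ (E + 2 * Real.exp E) + (E + 2 * Real.exp E) + B := by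
    have h1 := wmean_abs_pot_le W hWe hW0 hWnn N hN2 h2N hE hEF y
    have h2 := wmean_abs_pot_le W hWe hW0 hWnn N hN2 h2N hE hEF x
    calc wmean (jAmp W N) (fun σ => |X σ - 0|)
        ≤ wmean (jAmp W N) (fun σ => |jPot W y σ - jMeanPot W N| + (|jPot W x σ - jMeanPot W N| + B)) :=
          wmean_mono _ fun σ => by linarith [hXabs σ]
      _ = wmean (jAmp W N) (fun σ => |jPot W y σ - jMeanPot W N|)
            + (wmean (jAmp W N) (fun σ => |jPot W x σ - jMeanPot W N|) + B) := by
          rw [wmean_add, wmean_add, wmean_const _ _ hZ]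
      _ ≤ _ := by linarith
  have hnum : 0 ≤ 2 * E + 4 * Real.exp E + B := by positivity
  calc wcov (jAmp W N) (fun σ => occ σ x * (1 - occ σ y)) X / probPH (jAmp W N) x y
      ≤ (2 * E + 4 * Real.exp E + B) / probPH (jAmp W N) x y :=
        div_le_div_of_nonneg_right (hcov.trans (by linarith [hmeanX])) hPpos.le
    _ ≤ (2 * E + 4 * Real.exp E + B) / c₀ := div_le_div_of_nonneg_left hnum hc₀ hPc

/-- **ONE-STATE E-FLOOR for the canonical Jastrow state (PROVED):** a uniform bound `K` on the teleportation
entropies gives `n₀/|G| ≥ (N/|G|)(1 − N/|G|) e^{−K/2}` (homogeneity + one-state E-floor). [folklore] -/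
theorem condensateDensity_jAmp_ge_of_klDiv (W : G → ℝ) (N : ℕ) (hN : N ≤ Fintype.card G) (K : ℝ)
    (hK : ∀ x y : G, x ≠ y → klDiv (teleLaw (jAmp W N) x y) (teleLaw (jAmp W N) y x) ≤ K) :
    ((N : ℝ) / Fintype.card G) * (1 - (N : ℝ) / Fintype.card G) * Real.exp (-K / 2)
      ≤ condensateDensity (jAmp W N) := by
  have hZ := jastrowSectorWeight_jAmp_pos W N hN
  have hsect : ∀ σ, jAmp W N σ ≠ 0 → ((univ.filter fun z => σ z = 0).card : ℝ) = (N : ℝ) := by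
    intro σ hσ
    exact_mod_cast jAmp_support W N σ hσ
  exact condensateDensity_ge_of_teleEntropy' (jAmp W N) (N : ℝ) (siteDensity (jAmp W N) 0) K
    (jastrowSectorAmp_nonneg _ _) (sum_jastrowSectorAmp_sq _ _ hZ) hsect (siteDensity_jAmp_eq W N)
    (fun x y τ _ hτ => teleLaw_jastrowSector_pos_symm _ _ hZ x y τ hτ) hK

/-- **END-TO-END, RESAMPLING ROUTE (PROVED, kernel-generic):** particle–hole floor + energy floor ⟹
`n₀/|G| ≥ (N/|G|)(1 − N/|G|)·exp(−(2E + 4e^E + B)/(2c₀))` for the canonical Jastrow state of any even kernel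
`0 ≤ W ≤ B` with `W 0 = 0` (`2 ≤ N`, `2N ≤ |G|`). (theory seat Sketch9 Part P `condensate_of_energyFloor`, generalised) [folklore] -/
theorem condensateDensity_jAmp_ge_of_floors (W : G → ℝ) (hWe : ∀ z, W (-z) = W z) (hW0 : W 0 = 0)
    (hWnn : ∀ z, 0 ≤ W z) {B : ℝ} (hWB : ∀ z, W z ≤ B) (N : ℕ) (hN2 : 2 ≤ N) (h2N : 2 * N ≤ Fintype.card G)
    {c₀ E : ℝ} (hc₀ : 0 < c₀) (hE : 0 ≤ E) (hT0 : JastrowParticleHoleFloor W N c₀)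
    (hEF : JastrowEnergyFloor W N E) :
    ((N : ℝ) / Fintype.card G) * (1 - (N : ℝ) / Fintype.card G)
        * Real.exp (-((2 * E + 4 * Real.exp E + B) / c₀) / 2)
      ≤ condensateDensity (jAmp W N) :=
  condensateDensity_jAmp_ge_of_klDiv W N (by omega) _
    (fun x y hxy => klDiv_jAmp_le_of_energyFloor W hWe hW0 hWnn hWB N hN2 h2N hc₀ hE hT0 hEF x y hxy)

end JastrowResamplingKL

end Summit.HubbardSuperconductivity.HubbardSuperconductivity.Theorems.AnisotropyChord.InsertionEntropy
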